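import Summits.QuantumFields.BalabanUV.Beta.KernelLegPullback
import Summits.QuantumFields.BalabanUV.Beta.BubbleParity

/-!
# `BalabanUV.Beta.GAN24.FirstLegKernelLegPullback` — binder row G-an2-4 ∕ (CONV-C), row (C) at the levels `j ≥ 1`, CONTACT side; Part 19 of
# `GAN24/FourFaceGaugeSectors`: **THE FIRST-LEG TWIN OF an2's KERNEL-LEG LETTER** — the coarse divergence of the LEFT kernel leg of
# `mmRead Lc (K3OfK G_j Lc S M W b b′)` is MINUS `(stepScale d Lc j·Lc^{d+1})⁻¹ ×` the fine block pure gauge `gaugeWt` read on the LEFT field leg of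
# `(dM_b∘G_j∘dM_{b′} + dM_{b′}∘G_j∘dM_b − W_{bb′}) ∘ G_j` — every step `j`, every in-block root, the interior untouched; option (ii) of an2's W-an2-g49-11

NOT IN PRINT; OUR BOOKKEEPING (G-an2-4 crux team (2), leaf prover `b2b-balaban-gan24-formalise-leaf-02`, gen 66).  WHY.  Part 18 (`FirstLegSectorWardForm`) puts the
mixed slot–FIRST-leg sectors `{0,2}`, `{1,2}` of the next level's table in Ward-ready form against the pure-gauge divergence of the FIRST leg,
`Σ_γ (Y κ r κ′ u′ (x₀ − e_γ) z (inl γ)(inl β) − Y κ r κ′ u′ x₀ z (inl γ)(inl β))`; an2's letter `KernelLegPullback.mmRead_K3OfK_kernelLeg_coarseDiv` (row D1, p367797 ✓)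
is the SECOND-leg statement (divergence in `(y, β)`, pull-back through the RIGHT factor `G_j` of the sandwich `G_j ∘ Y ∘ G_j`).  an2's W-an2-g49-11 (journal
l.55248) offers (i) a `trK` transpose lemma if the interior is `trK`-symmetric up to the swap, else (ii) the first-leg twin.  The tree's chart of the propagator is
`BubbleParity.trK_coDressKBmAt_KInvStep : trK G_j = sgnK G_j` (`sgnF = +1` on field legs, `−1` on multiplier legs), and the typed first-order tables are
PLAIN-antisymmetric on the packed fibre (`SpineRootedS0.S0At_antisymm`) — sgn-symmetric on their off-diagonal part, sgn-antisymmetric on their block-diagonal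
part (`BubbleParity.sgnK_vertexOfK_S0At_vh ∕ _wl`) — so (i)'s premise `trK Y_{bb′} = sgnK Y_{b′b}` is not available for the typed interior.  THIS FILE types (ii),
hypothesis-free beyond the letter's own `Loc` data: the ROW laws of `G_j` are read off the COLUMN laws through `trK G_j = sgnK G_j` — a row-ℋ entry is MINUS the
column-ℋ entry (`sgnF (inl)·sgnF (inr) = −1`), a multiplier-row entry EQUALS the transposed multiplier-column entry (`sgnF (inr)² = 1`) — and the abstract pull-back
through the LEFT factor is an2's right pull-back applied to the transposed pair (`trK (K ∘ A) = trK A ∘ trK K`).  Hence the SIGN: the first-leg constant is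
`−(stepScale d Lc j·Lc^{d+1})⁻¹`.

WHAT ([folklore] kernel algebra BY NAME over an2's `KernelLegPullback` (§1 right pull-back, §2 `mulRow_coclosed_coDressKBmAt_KInvStep`, §3 `K3OfK_eq_sandwich`),
d1-leaf-07's `KernelWardHColumnWall.colH_ward_KInvStep_all`, an2's `BubbleParity.trK_coDressKBmAt_KInvStep`, `TameKernelCalculus`, `BorderedHessianSymmetry`;
0 `def`, 0 cited facts, 0 `def … : Prop`, 0 sorry):
* §1 `tame_trK` (transpose preserves `Tame`); **`mulLeg_coarseDiv_comp_left`** — ABSTRACT LEFT PULL-BACK: `K`, `A` tame,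
  `hH : Σ_μ (K (N•(y − e_μ)) u (inr μ) (inl κ′) − K (N•y) u (inr μ) (inl κ′)) = cH·gaugeWt N y κ′ u` (ROW-ℋ Ward law),
  `hM : Σ_μ (K (N•(y − e_μ)) v (inr μ) (inr ρ) − K (N•y) v (inr μ) (inr ρ)) = 0` (multiplier COLUMNS co-closed in the target slot) ⟹
  `Σ_μ ((K∘A) (N•(y − e_μ)) z (inr μ) b − (K∘A) (N•y) z (inr μ) b) = cH · Σ'_v Σ_κ′ gaugeWt N y κ′ v·A v z (inl κ′) b`.
* §2 the wall propagators `G_j = coDressKBmAt (toSite r) Lc (KInvStep Lc j)`, in-block root `r`: `rowH_eq_neg_colH` (`G_j (Lc•y) u (inr μ) (inl κ′) = −colH G_j Lc μ y κ′ u`),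
  `mulCol_eq_mulRow` (`G_j (Lc•y) v (inr μ) (inr ρ) = G_j v (Lc•y) (inr ρ) (inr μ)`), **`rowH_ward`** (the ROW-ℋ Ward law, constant `−(stepScale d Lc j·Lc^{d+1})⁻¹`),
  `mulCol_coclosed`, **`mulLeg_coarseDiv_comp_coDressKBmAt_KInvStep_left`** (§1 at `K := G_j`, every tame `A`).
* §3 **`mmRead_K3OfK_kernelLeg_coarseDiv_left`** — THE FIRST-LEG TWIN OF THE LETTER:
  `Σ_γ (mmRead Lc (K3OfK G_j Lc S M W b b′) (x − e_γ) z (inl γ) (inl β) − mmRead Lc (K3OfK G_j …) x z (inl γ) (inl β))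
   = −(stepScale d Lc j·Lc^{d+1})⁻¹ · Σ'_v Σ_κ′ gaugeWt Lc x κ′ v·(Y ∘ G_j) v (Lc•z) (inl κ′) (inr β)`, `Y := dM_b∘G_j∘dM_{b′} + dM_{b′}∘G_j∘dM_b − W_{bb′}`,
  under the letter's hypotheses `Loc (dM_b)`, `Loc (dM_{b′})`, `Loc (W_{bb′})` verbatim.
* §4 `tsum_mul_gaugeWt`, `tsum_sum_mul_gaugeWt`, `tsum_sum_gaugeWt_mul` (a `gaugeWt`-weighted series is the block sum over `B(y)` of the FINE differences — scalar
  forms of an2's `KernelWardRelative.wsum_gaugeWt`); **`mmRead_K3OfK_kernelLeg_coarseDiv_eq_blockSum`** (an2's letter) and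
  **`mmRead_K3OfK_kernelLeg_coarseDiv_left_eq_blockSum`** (its first-leg twin) IN BLOCK-SUM FORM: coarse divergence of a kernel leg at level `j+1` = `±cH_j ×` the
  block sum of the FINE divergence of the corresponding field leg of the sandwich at level `j` — the shape the field-leg laws one level down consume.
HONEST FRAMING (cell contract, verbatim): «discharging `BetaPertH` makes Bałaban's UV stability UNCONDITIONAL — a real constructive-QFT result; it is NOT the
continuum limit and NOT the Clay problem.»  HONEST DEPENDENCY (verbatim): «continuum YM on T⁴ ⇐ BetaPertH ∧ nine spine estimates (0/9 proved); BetaPertH ⇐ (D1)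
∧ (D4) ∧ CAP+tail; G-an2-4 gates asym, D1 and NE2/3/4.»  Bookkeeping only: the Ward content is d1-leaf-07's column Ward law and an1's multiplier-column law,
used BY NAME through an2's letter file; NO estimate of Bałaban's; discharges NOTHING of (C) ∕ (C)sym ∕ (Q-L) ∕ «T2Shape» ∕ «T2Drift» ∕ (hW, hWall); 0 wall
binders; NEVER «G-an2-4 closed» as (CONV-C); NOT D1, NOT BetaPertH, NOT continuum, NOT Clay.  2026-08-23.
-/

open Finset
open scoped BigOperators
open Literature.MathematicalPhysics.QuantumFieldTheory
open Literature.MathematicalPhysics.QuantumFieldTheory.Balaban1983to89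
open Literature.MathematicalPhysics.QuantumFieldTheory.Balaban1983to89.Beta
open ExpKernelCalculus (MKer comp)
open AffineAveraging (box toSite)
open B6BondElimination (unitVec)
open OneStepResolventKernel (Fib)
open OneStepKernelFamily (KInvStep colH)
open SecondOrderResponse (dM)
open BalabanStepW2 (K3OfK)
open BalabanStepJetsSucc (mmRead mmRead_inl_inl)
open Summit.QuantumFields.BalabanUV.Beta.TameKernelCalculus
open Summit.QuantumFields.BalabanUV.Beta.AxialDressingRooted (coDressKBmAt spr_coDressKBmAt one_le_of_neZero)
open Summit.QuantumFields.BalabanUV.Beta.BorderedHessian (stepScale spr_KInvStep sgnF sgnF_inl sgnF_inr sgnK sgnK_apply)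
open Summit.QuantumFields.BalabanUV.Beta.KernelWardRelative (gaugeWt wsum_gaugeWt summable_blockInd_mul)
open Summit.QuantumFields.BalabanUV.Beta.KernelWardHColumnWall (colH_ward_KInvStep_all)
open Summit.QuantumFields.BalabanUV.Beta.KernelLegPullback (mulLeg_coarseDiv_comp_right mulRow_coclosed_coDressKBmAt_KInvStep K3OfK_eq_sandwich)
open Summit.QuantumFields.BalabanUV.Beta.BubbleParity (trK_coDressKBmAt_KInvStep)

namespace Summit.QuantumFields.BalabanUV.Beta.GAN24.FirstLegKernelLegPullback

noncomputable section

variable {d : ℕ}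

/-! ## §1 The abstract pull-back through the LEFT factor -/

section Abstract

variable {N : ℕ}

/-- [folklore] Transposition preserves tameness (row and column majorants exchanged, the uniform bound kept). -/
theorem tame_trK {K : MKer (d + 1) (Fib d)} (h : Tame K) : Tame (trK K) := by
  obtain ⟨hrow, hcol, B, hB⟩ := h
  refine ⟨fun x => ?_, fun z => ?_, ⟨B, fun x y a b => hB y x b a⟩⟩
  · obtain ⟨ψ, hψ, hψ0, hle⟩ := hcol x
    exact ⟨ψ, hψ, hψ0, fun y a f => hle y f a⟩
  · obtain ⟨φ, hφ, hφ0, hle⟩ := hrow z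
    exact ⟨φ, hφ, hφ0, fun y f b => hle y b f⟩

/-- [folklore] **THE OUTER-LEG PULL-BACK (left factor)**: for tame `K`, `A`, if the ℋ-ROWS of `K` obey the row Ward law with constant `cH` in the source
slot and the multiplier COLUMNS of `K` are co-closed there, then the coarse divergence of the left MULTIPLIER leg of `K ∘ A` equals `cH` times the block pure
gauge `gaugeWt N y` read on the left FIELD leg of `A` — an2's `KernelLegPullback.mulLeg_coarseDiv_comp_right` for the transposed pair, `trK (K∘A) = trK A ∘ trK K`. -/
theorem mulLeg_coarseDiv_comp_left {K A : MKer (d + 1) (Fib d)} (hK : Tame K) (hA : Tame A) {cH : ℝ}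
    (hH : ∀ (y : Fin (d + 1) → ℤ) (κ' : Fin (d + 1)) (u : Fin (d + 1) → ℤ),
      ∑ μ, (K ((N : ℤ) • (y - unitVec μ)) u (Sum.inr μ) (Sum.inl κ') - K ((N : ℤ) • y) u (Sum.inr μ) (Sum.inl κ')) = cH * gaugeWt N y κ' u)
    (hM : ∀ (v y : Fin (d + 1) → ℤ) (ρ : Fin (d + 1)),
      ∑ μ, (K ((N : ℤ) • (y - unitVec μ)) v (Sum.inr μ) (Sum.inr ρ) - K ((N : ℤ) • y) v (Sum.inr μ) (Sum.inr ρ)) = 0)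
    (z : Fin (d + 1) → ℤ) (b : Fib d) (y : Fin (d + 1) → ℤ) :
    ∑ μ, (comp K A ((N : ℤ) • (y - unitVec μ)) z (Sum.inr μ) b - comp K A ((N : ℤ) • y) z (Sum.inr μ) b) =
      cH * ∑' v, ∑ κ', gaugeWt N y κ' v * A v z (Sum.inl κ') b := by
  have h := mulLeg_coarseDiv_comp_right (N := N) (tame_trK hA) (tame_trK hK) (cH := cH)
    (fun y' κ' u => hH y' κ' u) (fun v y' ρ => hM v y' ρ) z b y
  rw [← trK_comp] at h
  simp only [trK_apply] at h
  rw [h]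
  exact congrArg _ (tsum_congr fun v => Finset.sum_congr rfl fun κ' _ => mul_comm _ _)

end Abstract

/-! ## §2 The wall propagators `G_j = coDressKBmAt (toSite r) Lc (KInvStep Lc j)`: row laws from the column laws through `trK G_j = sgnK G_j` -/

section Wall

variable {Lc : ℕ} [NeZero Lc] {r : Fin (d + 1) → ℕ}

/-- [folklore] **A ROW-ℋ ENTRY OF `G_j` IS MINUS THE COLUMN-ℋ ENTRY** (in-block root): `G_j (Lc•y) u (inr μ) (inl κ′) = −colH G_j Lc μ y κ′ u`
(`trK G_j = sgnK G_j`, `sgnF (inl κ′)·sgnF (inr μ) = −1`). -/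
theorem rowH_eq_neg_colH (hr : r ∈ box (d + 1) Lc) (j : ℕ) (y u : Fin (d + 1) → ℤ) (μ κ' : Fin (d + 1)) :
    coDressKBmAt (toSite r) Lc (KInvStep (d := d) Lc j) ((Lc : ℤ) • y) u (Sum.inr μ) (Sum.inl κ') =
      -colH (coDressKBmAt (toSite r) Lc (KInvStep (d := d) Lc j)) Lc μ y κ' u := by
  have h := congrFun (congrFun (congrFun (congrFun (trK_coDressKBmAt_KInvStep (d := d) hr j) u) ((Lc : ℤ) • y)) (Sum.inl κ')) (Sum.inr μ)
  rw [trK_apply, sgnK_apply, sgnF_inl, sgnF_inr] at h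
  rw [h]
  simp only [colH]
  ring

/-- [folklore] **A MULTIPLIER-ROW ENTRY OF `G_j` IN THE SOURCE SLOT IS THE TRANSPOSED MULTIPLIER-COLUMN ENTRY** (in-block root):
`G_j (Lc•y) v (inr μ) (inr ρ) = G_j v (Lc•y) (inr ρ) (inr μ)` (`trK G_j = sgnK G_j`, `sgnF (inr ρ)·sgnF (inr μ) = 1`). -/
theorem mulCol_eq_mulRow (hr : r ∈ box (d + 1) Lc) (j : ℕ) (y v : Fin (d + 1) → ℤ) (μ ρ : Fin (d + 1)) :
    coDressKBmAt (toSite r) Lc (KInvStep (d := d) Lc j) ((Lc : ℤ) • y) v (Sum.inr μ) (Sum.inr ρ) =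
      coDressKBmAt (toSite r) Lc (KInvStep (d := d) Lc j) v ((Lc : ℤ) • y) (Sum.inr ρ) (Sum.inr μ) := by
  have h := congrFun (congrFun (congrFun (congrFun (trK_coDressKBmAt_KInvStep (d := d) hr j) v) ((Lc : ℤ) • y)) (Sum.inr ρ)) (Sum.inr μ)
  rw [trK_apply, sgnK_apply, sgnF_inr, sgnF_inr] at h
  rw [h]
  ring

/-- [folklore] **THE ROW-ℋ WARD LAW OF `G_j`** (in-block root, every step `j`): the coarse divergence, in the source slot, of the ℋ-ROWS of `G_j` is
`−(stepScale d Lc j·Lc^{d+1})⁻¹ ×` the fine block pure gauge — d1-leaf-07's column law `KernelWardHColumnWall.colH_ward_KInvStep_all` read through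
`rowH_eq_neg_colH`; the SIGN is the multiplier leg's `sgnF = −1`. -/
theorem rowH_ward (hr : r ∈ box (d + 1) Lc) (j : ℕ) (y : Fin (d + 1) → ℤ) (κ' : Fin (d + 1)) (u : Fin (d + 1) → ℤ) :
    ∑ μ, (coDressKBmAt (toSite r) Lc (KInvStep (d := d) Lc j) ((Lc : ℤ) • (y - unitVec μ)) u (Sum.inr μ) (Sum.inl κ')
      - coDressKBmAt (toSite r) Lc (KInvStep (d := d) Lc j) ((Lc : ℤ) • y) u (Sum.inr μ) (Sum.inl κ')) =
      -(stepScale d Lc j * (Lc : ℝ) ^ (d + 1))⁻¹ * gaugeWt Lc y κ' u := by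
  simp_rw [rowH_eq_neg_colH hr j]
  have e : ∑ μ, (-colH (coDressKBmAt (toSite r) Lc (KInvStep (d := d) Lc j)) Lc μ (y - unitVec μ) κ' u
      - -colH (coDressKBmAt (toSite r) Lc (KInvStep (d := d) Lc j)) Lc μ y κ' u) =
      -∑ μ, (colH (coDressKBmAt (toSite r) Lc (KInvStep (d := d) Lc j)) Lc μ (y - unitVec μ) κ' u
        - colH (coDressKBmAt (toSite r) Lc (KInvStep (d := d) Lc j)) Lc μ y κ' u) := by
    rw [← Finset.sum_neg_distrib]
    exact Finset.sum_congr rfl fun μ _ => by ring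
  rw [e, colH_ward_KInvStep_all hr j y κ' u]
  ring

/-- [folklore] **THE MULTIPLIER COLUMNS OF `G_j` ARE CO-CLOSED IN THE SOURCE SLOT, FINE FORM** (in-block root): for every fine `v`,
`Σ_μ (G_j (Lc•(y − e_μ)) v (inr μ) (inr ρ) − G_j (Lc•y) v (inr μ) (inr ρ)) = 0` — an2's `KernelLegPullback.mulRow_coclosed_coDressKBmAt_KInvStep` read through
`mulCol_eq_mulRow`. -/
theorem mulCol_coclosed (hr : r ∈ box (d + 1) Lc) (j : ℕ) (v y : Fin (d + 1) → ℤ) (ρ : Fin (d + 1)) :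
    ∑ μ, (coDressKBmAt (toSite r) Lc (KInvStep (d := d) Lc j) ((Lc : ℤ) • (y - unitVec μ)) v (Sum.inr μ) (Sum.inr ρ)
      - coDressKBmAt (toSite r) Lc (KInvStep (d := d) Lc j) ((Lc : ℤ) • y) v (Sum.inr μ) (Sum.inr ρ)) = 0 := by
  simp_rw [mulCol_eq_mulRow hr j]
  exact mulRow_coclosed_coDressKBmAt_KInvStep (toSite r) j v y ρ

/-- [folklore] **THE OUTER-LEG PULL-BACK THROUGH THE LEFT WALL PROPAGATOR**, every step `j`, every in-block root `r`, every tame `A`: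
`Σ_μ ((G_j∘A) (Lc•(y − e_μ)) z (inr μ) b − (G_j∘A) (Lc•y) z (inr μ) b) = −(stepScale d Lc j·Lc^{d+1})⁻¹ · Σ'_v Σ_κ′ gaugeWt Lc y κ′ v·A v z (inl κ′) b`. -/
theorem mulLeg_coarseDiv_comp_coDressKBmAt_KInvStep_left (hr : r ∈ box (d + 1) Lc) (j : ℕ) {A : MKer (d + 1) (Fib d)} (hA : Tame A)
    (z : Fin (d + 1) → ℤ) (b : Fib d) (y : Fin (d + 1) → ℤ) :
    ∑ μ, (comp (coDressKBmAt (toSite r) Lc (KInvStep (d := d) Lc j)) A ((Lc : ℤ) • (y - unitVec μ)) z (Sum.inr μ) b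
      - comp (coDressKBmAt (toSite r) Lc (KInvStep (d := d) Lc j)) A ((Lc : ℤ) • y) z (Sum.inr μ) b) =
      -(stepScale d Lc j * (Lc : ℝ) ^ (d + 1))⁻¹ * ∑' v, ∑ κ', gaugeWt Lc y κ' v * A v z (Sum.inl κ') b := by
  have hG : Spr (coDressKBmAt (toSite r) Lc (KInvStep (d := d) Lc j)) :=
    spr_coDressKBmAt (one_le_of_neZero Lc) hr (spr_KInvStep j)
  exact mulLeg_coarseDiv_comp_left hG.tame hA (fun y' κ' u => rowH_ward hr j y' κ' u)
    (fun v y' ρ' => mulCol_coclosed hr j v y' ρ') z b y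

end Wall

/-! ## §3 The first-leg twin of the kernel-leg letter -/

section Sandwich

variable {Lc : ℕ} [NeZero Lc] {r : Fin (d + 1) → ℕ}

/-- NOT IN PRINT; OUR BOOKKEEPING.  **THE KERNEL-LEG PULL-BACK OF THE SECOND BOND-DERIVATIVE READ-OUT THROUGH THE LEFT WALL PROPAGATOR — THE FIRST-LEG
TWIN OF an2's `KernelLegPullback.mmRead_K3OfK_kernelLeg_coarseDiv`** (every step `j`, in-block root `r`, localised `dM_b`, `dM_{b′}`, `W_{bb′}`): with
`G_j := coDressKBmAt (toSite r) Lc (KInvStep Lc j)` and the interior `Y := dM_b∘G_j∘dM_{b′} + dM_{b′}∘G_j∘dM_b − W_{bb′}`, the coarse divergence of the LEFT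
KERNEL leg of `mmRead Lc (K3OfK G_j Lc S M W b b′)` (an2's `e4OfKW`, the E-sector of `T2RecAt (j+1)` up to its weight) is MINUS the column Ward constant times
the fine block pure gauge read on the LEFT field leg of `Y ∘ G_j`:
`Σ_γ (mmRead Lc (K3OfK G_j …) (x − e_γ) z (inl γ) (inl β) − mmRead Lc (K3OfK G_j …) x z (inl γ) (inl β))
 = −(stepScale d Lc j·Lc^{d+1})⁻¹ · Σ'_v Σ_κ′ gaugeWt Lc x κ′ v·(Y ∘ G_j) v (Lc•z) (inl κ′) (inr β)`. -/
theorem mmRead_K3OfK_kernelLeg_coarseDiv_left (hr : r ∈ box (d + 1) Lc) (j : ℕ)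
    (S M : Fin (d + 1) → (Fin (d + 1) → ℤ) → MKer (d + 1) (Fib d))
    (W : Fin (d + 1) → (Fin (d + 1) → ℤ) → Fin (d + 1) → (Fin (d + 1) → ℤ) → MKer (d + 1) (Fib d))
    (μ : Fin (d + 1)) (yb : Fin (d + 1) → ℤ) (ν : Fin (d + 1)) (yb' : Fin (d + 1) → ℤ)
    (hDμ : Loc (dM (coDressKBmAt (toSite r) Lc (KInvStep (d := d) Lc j)) Lc S M μ yb))
    (hDν : Loc (dM (coDressKBmAt (toSite r) Lc (KInvStep (d := d) Lc j)) Lc S M ν yb'))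
    (hW : Loc (W μ yb ν yb')) (z : Fin (d + 1) → ℤ) (β : Fin (d + 1)) (x : Fin (d + 1) → ℤ) :
    ∑ γ, (mmRead Lc (K3OfK (coDressKBmAt (toSite r) Lc (KInvStep (d := d) Lc j)) Lc S M W μ yb ν yb') (x - unitVec γ) z (Sum.inl γ) (Sum.inl β)
      - mmRead Lc (K3OfK (coDressKBmAt (toSite r) Lc (KInvStep (d := d) Lc j)) Lc S M W μ yb ν yb') x z (Sum.inl γ) (Sum.inl β)) =
      -(stepScale d Lc j * (Lc : ℝ) ^ (d + 1))⁻¹ *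
        ∑' v, ∑ κ', gaugeWt Lc x κ' v *
          comp (comp (comp (dM (coDressKBmAt (toSite r) Lc (KInvStep (d := d) Lc j)) Lc S M μ yb) (coDressKBmAt (toSite r) Lc (KInvStep (d := d) Lc j)))
              (dM (coDressKBmAt (toSite r) Lc (KInvStep (d := d) Lc j)) Lc S M ν yb') +
            comp (comp (dM (coDressKBmAt (toSite r) Lc (KInvStep (d := d) Lc j)) Lc S M ν yb') (coDressKBmAt (toSite r) Lc (KInvStep (d := d) Lc j)))
              (dM (coDressKBmAt (toSite r) Lc (KInvStep (d := d) Lc j)) Lc S M μ yb) - W μ yb ν yb')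
            (coDressKBmAt (toSite r) Lc (KInvStep (d := d) Lc j)) v ((Lc : ℤ) • z) (Sum.inl κ') (Sum.inr β) := by
  set G := coDressKBmAt (toSite r) Lc (KInvStep (d := d) Lc j) with hGdef
  have hG : Spr G := spr_coDressKBmAt (one_le_of_neZero Lc) hr (spr_KInvStep j)
  set Y := comp (comp (dM G Lc S M μ yb) G) (dM G Lc S M ν yb') + comp (comp (dM G Lc S M ν yb') G) (dM G Lc S M μ yb) - W μ yb ν yb' with hYdef
  have hY : Loc Y := (((hDμ.comp_spr hG).comp hDν).add ((hDν.comp_spr hG).comp hDμ)).sub hW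
  have hA : Tame (comp Y G) := (hY.comp_spr hG).tame
  have e : K3OfK G Lc S M W μ yb ν yb' = comp G (comp Y G) := by
    rw [K3OfK_eq_sandwich hG Lc S M W μ yb ν yb' hDμ hDν hW, ← hYdef, ← comp_assoc_tame hG.tame hY.tame hG.tame]
  simp only [mmRead_inl_inl, e]
  exact mulLeg_coarseDiv_comp_coDressKBmAt_KInvStep_left hr j hA ((Lc : ℤ) • z) (Sum.inr β) x

end Sandwich

/-! ## §4 The `gaugeWt`-reads as block sums of FINE field-leg divergences (both letters) -/

section BlockSum

variable {N : ℕ}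

/-- [folklore] **A `gaugeWt`-WEIGHTED SERIES IS A BLOCK SUM OF FINE DIFFERENCES** (scalar form of an2's `KernelWardRelative.wsum_gaugeWt`; the weight has finite
support, no summability asked): `Σ'_v f v·gaugeWt N y κ′ v = Σ_{v₀∈box N} (f (N•y + v₀ − e_κ′) − f (N•y + v₀))`. -/
theorem tsum_mul_gaugeWt (hN : 1 ≤ N) (f : (Fin (d + 1) → ℤ) → ℝ) (y : Fin (d + 1) → ℤ) (κ' : Fin (d + 1)) :
    ∑' v, f v * gaugeWt N y κ' v = ∑ v₀ ∈ box (d + 1) N, (f ((N : ℤ) • y + toSite v₀ - unitVec κ') - f ((N : ℤ) • y + toSite v₀)) := by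
  have h := wsum_gaugeWt (d := d) hN 1 y κ' (fun u => fun _ _ _ _ => f u)
  have h' := congrFun (congrFun (congrFun (congrFun h 0) 0) (Sum.inl 0)) (Sum.inl 0)
  simp only [OneStepResolventKernel.wsum, one_mul, one_smul, Finset.sum_apply, Pi.sub_apply] at h'
  rw [← h']
  exact tsum_congr fun v => mul_comm _ _

/-- [folklore] The fibre-summed form: `Σ'_v Σ_κ′ f v κ′·gaugeWt N y κ′ v = Σ_{v₀∈box N} Σ_κ′ (f (N•y + v₀ − e_κ′) κ′ − f (N•y + v₀) κ′)` — the block sum over `B(y)` of the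
FINE divergence (`KernelWard.divV` orientation) of the 1-form `f`. -/
theorem tsum_sum_mul_gaugeWt (hN : 1 ≤ N) (f : (Fin (d + 1) → ℤ) → Fin (d + 1) → ℝ) (y : Fin (d + 1) → ℤ) :
    ∑' v, ∑ κ', f v κ' * gaugeWt N y κ' v =
      ∑ v₀ ∈ box (d + 1) N, ∑ κ', (f ((N : ℤ) • y + toSite v₀ - unitVec κ') κ' - f ((N : ℤ) • y + toSite v₀) κ') := by
  have hs : ∀ κ' : Fin (d + 1), Summable fun v => f v κ' * gaugeWt N y κ' v := by
    intro κ'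
    have h1 := summable_blockInd_mul hN y (unitVec κ') (fun v => f v κ')
    have h2 := summable_blockInd_mul hN y 0 (fun v => f v κ')
    simp only [add_zero] at h2
    refine (h1.sub h2).congr fun v => ?_
    simp only [gaugeWt]
    ring
  rw [Summable.tsum_finsetSum (fun κ' _ => hs κ'), Finset.sum_comm]
  exact Finset.sum_congr rfl fun κ' _ => tsum_mul_gaugeWt hN (fun v => f v κ') y κ'

/-- [folklore] The same with the weight on the left: `Σ'_v Σ_κ′ gaugeWt N y κ′ v·f v κ′ = Σ_{v₀∈box N} Σ_κ′ (f (N•y + v₀ − e_κ′) κ′ − f (N•y + v₀) κ′)`. -/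
theorem tsum_sum_gaugeWt_mul (hN : 1 ≤ N) (f : (Fin (d + 1) → ℤ) → Fin (d + 1) → ℝ) (y : Fin (d + 1) → ℤ) :
    ∑' v, ∑ κ', gaugeWt N y κ' v * f v κ' =
      ∑ v₀ ∈ box (d + 1) N, ∑ κ', (f ((N : ℤ) • y + toSite v₀ - unitVec κ') κ' - f ((N : ℤ) • y + toSite v₀) κ') := by
  rw [← tsum_sum_mul_gaugeWt hN f y]
  exact tsum_congr fun v => Finset.sum_congr rfl fun κ' _ => mul_comm _ _

end BlockSum

section BlockSumWall

variable {Lc : ℕ} [NeZero Lc] {r : Fin (d + 1) → ℕ}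

/-- NOT IN PRINT; OUR BOOKKEEPING.  **an2's LETTER IN BLOCK-SUM FORM**: the coarse divergence of the RIGHT kernel leg of `mmRead Lc (K3OfK G_j …)` at the coarse site `y` is
`(stepScale d Lc j·Lc^{d+1})⁻¹ ×` the sum over the fine block `B(y)` of the FINE divergence of the right field leg of `G_j ∘ Y` — «coarse divergence of the kernel leg
at level `j+1` = `cH_j ×` block-summed fine divergence of the sandwich's field leg at level `j`», the shape the field-leg laws one level down consume. -/
theorem mmRead_K3OfK_kernelLeg_coarseDiv_eq_blockSum (hr : r ∈ box (d + 1) Lc) (j : ℕ)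
    (S M : Fin (d + 1) → (Fin (d + 1) → ℤ) → MKer (d + 1) (Fib d))
    (W : Fin (d + 1) → (Fin (d + 1) → ℤ) → Fin (d + 1) → (Fin (d + 1) → ℤ) → MKer (d + 1) (Fib d))
    (μ : Fin (d + 1)) (yb : Fin (d + 1) → ℤ) (ν : Fin (d + 1)) (yb' : Fin (d + 1) → ℤ)
    (hDμ : Loc (dM (coDressKBmAt (toSite r) Lc (KInvStep (d := d) Lc j)) Lc S M μ yb))
    (hDν : Loc (dM (coDressKBmAt (toSite r) Lc (KInvStep (d := d) Lc j)) Lc S M ν yb'))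
    (hW : Loc (W μ yb ν yb')) (x' : Fin (d + 1) → ℤ) (α : Fin (d + 1)) (y : Fin (d + 1) → ℤ) :
    ∑ β, (mmRead Lc (K3OfK (coDressKBmAt (toSite r) Lc (KInvStep (d := d) Lc j)) Lc S M W μ yb ν yb') x' (y - unitVec β) (Sum.inl α) (Sum.inl β)
      - mmRead Lc (K3OfK (coDressKBmAt (toSite r) Lc (KInvStep (d := d) Lc j)) Lc S M W μ yb ν yb') x' y (Sum.inl α) (Sum.inl β)) =
      (stepScale d Lc j * (Lc : ℝ) ^ (d + 1))⁻¹ *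
        ∑ v₀ ∈ box (d + 1) Lc, ∑ κ',
          (comp (coDressKBmAt (toSite r) Lc (KInvStep (d := d) Lc j))
              (comp (comp (dM (coDressKBmAt (toSite r) Lc (KInvStep (d := d) Lc j)) Lc S M μ yb) (coDressKBmAt (toSite r) Lc (KInvStep (d := d) Lc j)))
              (dM (coDressKBmAt (toSite r) Lc (KInvStep (d := d) Lc j)) Lc S M ν yb') +
            comp (comp (dM (coDressKBmAt (toSite r) Lc (KInvStep (d := d) Lc j)) Lc S M ν yb') (coDressKBmAt (toSite r) Lc (KInvStep (d := d) Lc j)))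
              (dM (coDressKBmAt (toSite r) Lc (KInvStep (d := d) Lc j)) Lc S M μ yb) - W μ yb ν yb')
              ((Lc : ℤ) • x') ((Lc : ℤ) • y + toSite v₀ - unitVec κ') (Sum.inr α) (Sum.inl κ') -
            comp (coDressKBmAt (toSite r) Lc (KInvStep (d := d) Lc j))
              (comp (comp (dM (coDressKBmAt (toSite r) Lc (KInvStep (d := d) Lc j)) Lc S M μ yb) (coDressKBmAt (toSite r) Lc (KInvStep (d := d) Lc j)))
              (dM (coDressKBmAt (toSite r) Lc (KInvStep (d := d) Lc j)) Lc S M ν yb') +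
            comp (comp (dM (coDressKBmAt (toSite r) Lc (KInvStep (d := d) Lc j)) Lc S M ν yb') (coDressKBmAt (toSite r) Lc (KInvStep (d := d) Lc j)))
              (dM (coDressKBmAt (toSite r) Lc (KInvStep (d := d) Lc j)) Lc S M μ yb) - W μ yb ν yb')
              ((Lc : ℤ) • x') ((Lc : ℤ) • y + toSite v₀) (Sum.inr α) (Sum.inl κ')) := by
  rw [KernelLegPullback.mmRead_K3OfK_kernelLeg_coarseDiv hr j S M W μ yb ν yb' hDμ hDν hW x' α y,
    tsum_sum_mul_gaugeWt (one_le_of_neZero Lc)]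

/-- NOT IN PRINT; OUR BOOKKEEPING.  **THE FIRST-LEG TWIN IN BLOCK-SUM FORM**: the coarse divergence of the LEFT kernel leg of `mmRead Lc (K3OfK G_j …)` at the coarse site `x`
is `−(stepScale d Lc j·Lc^{d+1})⁻¹ ×` the sum over the fine block `B(x)` of the FINE divergence of the left field leg of `Y ∘ G_j`. -/
theorem mmRead_K3OfK_kernelLeg_coarseDiv_left_eq_blockSum (hr : r ∈ box (d + 1) Lc) (j : ℕ)
    (S M : Fin (d + 1) → (Fin (d + 1) → ℤ) → MKer (d + 1) (Fib d))
    (W : Fin (d + 1) → (Fin (d + 1) → ℤ) → Fin (d + 1) → (Fin (d + 1) → ℤ) → MKer (d + 1) (Fib d))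
    (μ : Fin (d + 1)) (yb : Fin (d + 1) → ℤ) (ν : Fin (d + 1)) (yb' : Fin (d + 1) → ℤ)
    (hDμ : Loc (dM (coDressKBmAt (toSite r) Lc (KInvStep (d := d) Lc j)) Lc S M μ yb))
    (hDν : Loc (dM (coDressKBmAt (toSite r) Lc (KInvStep (d := d) Lc j)) Lc S M ν yb'))
    (hW : Loc (W μ yb ν yb')) (z : Fin (d + 1) → ℤ) (β : Fin (d + 1)) (x : Fin (d + 1) → ℤ) :
    ∑ γ, (mmRead Lc (K3OfK (coDressKBmAt (toSite r) Lc (KInvStep (d := d) Lc j)) Lc S M W μ yb ν yb') (x - unitVec γ) z (Sum.inl γ) (Sum.inl β)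
      - mmRead Lc (K3OfK (coDressKBmAt (toSite r) Lc (KInvStep (d := d) Lc j)) Lc S M W μ yb ν yb') x z (Sum.inl γ) (Sum.inl β)) =
      -(stepScale d Lc j * (Lc : ℝ) ^ (d + 1))⁻¹ *
        ∑ v₀ ∈ box (d + 1) Lc, ∑ κ',
          (comp (comp (comp (dM (coDressKBmAt (toSite r) Lc (KInvStep (d := d) Lc j)) Lc S M μ yb) (coDressKBmAt (toSite r) Lc (KInvStep (d := d) Lc j)))
              (dM (coDressKBmAt (toSite r) Lc (KInvStep (d := d) Lc j)) Lc S M ν yb') +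
            comp (comp (dM (coDressKBmAt (toSite r) Lc (KInvStep (d := d) Lc j)) Lc S M ν yb') (coDressKBmAt (toSite r) Lc (KInvStep (d := d) Lc j)))
              (dM (coDressKBmAt (toSite r) Lc (KInvStep (d := d) Lc j)) Lc S M μ yb) - W μ yb ν yb')
              (coDressKBmAt (toSite r) Lc (KInvStep (d := d) Lc j)) ((Lc : ℤ) • x + toSite v₀ - unitVec κ') ((Lc : ℤ) • z) (Sum.inl κ') (Sum.inr β) -
            comp (comp (comp (dM (coDressKBmAt (toSite r) Lc (KInvStep (d := d) Lc j)) Lc S M μ yb) (coDressKBmAt (toSite r) Lc (KInvStep (d := d) Lc j)))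
              (dM (coDressKBmAt (toSite r) Lc (KInvStep (d := d) Lc j)) Lc S M ν yb') +
            comp (comp (dM (coDressKBmAt (toSite r) Lc (KInvStep (d := d) Lc j)) Lc S M ν yb') (coDressKBmAt (toSite r) Lc (KInvStep (d := d) Lc j)))
              (dM (coDressKBmAt (toSite r) Lc (KInvStep (d := d) Lc j)) Lc S M μ yb) - W μ yb ν yb')
              (coDressKBmAt (toSite r) Lc (KInvStep (d := d) Lc j)) ((Lc : ℤ) • x + toSite v₀) ((Lc : ℤ) • z) (Sum.inl κ') (Sum.inr β)) := by
  rw [mmRead_K3OfK_kernelLeg_coarseDiv_left hr j S M W μ yb ν yb' hDμ hDν hW z β x,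
    tsum_sum_gaugeWt_mul (one_le_of_neZero Lc) (fun v κ' => comp (comp (comp (dM (coDressKBmAt (toSite r) Lc (KInvStep (d := d) Lc j)) Lc S M μ yb) (coDressKBmAt (toSite r) Lc (KInvStep (d := d) Lc j)))
              (dM (coDressKBmAt (toSite r) Lc (KInvStep (d := d) Lc j)) Lc S M ν yb') +
            comp (comp (dM (coDressKBmAt (toSite r) Lc (KInvStep (d := d) Lc j)) Lc S M ν yb') (coDressKBmAt (toSite r) Lc (KInvStep (d := d) Lc j)))
              (dM (coDressKBmAt (toSite r) Lc (KInvStep (d := d) Lc j)) Lc S M μ yb) - W μ yb ν yb')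
      (coDressKBmAt (toSite r) Lc (KInvStep (d := d) Lc j)) v ((Lc : ℤ) • z) (Sum.inl κ') (Sum.inr β)) x]

end BlockSumWall

end

end Summit.QuantumFields.BalabanUV.Beta.GAN24.FirstLegKernelLegPullback
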